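import Summits.CriticalPhenomena.CardyFormulaZ2.Theorems.CardyBoundaryCoulombGasRectilinearCardyIffCubeRootLawPart1

/-!
# The crux `RectilinearCardy` is EQUIVALENT to the cube-root law of the `d`-most joined vertex
# (line `excursion-kernel-covariance`, crux stmt-CriticalPhenomena-5660, route `CardyBoundaryCoulombGas`)

Continuation lead `prover-line-stmt-CriticalPhenomena-5660-c1-0`, 2026-08-16 (cycle c1-1). After wave 1
of the reshaped skeleton `Cruxes/RectilinearCardy/Lines/excursion_kernel_covariance.lean` every
registered stub except the lever is a tree theorem (`stub_flatMarksReduction` p119964,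
`stub_boundaryCorrespondence` p118200, `stub_continuumTail` p118558, `stub_schwarzExtension` p119444,
`stub_kernelPointAsymptotics` p121243, `stub_kernelWindowLaw` p123083, plus the first lead's
`stub_boundaryArmTightness` p95609 and `stub_finiteCorners` p85706). The tools are in Part 1
(`…IffCubeRootLawPart1.lean`); this file records the two consequences, both UNCONDITIONAL theorems of the tree:

* `rectilinearCardy_of_cubeRootLaw` — SUFFICIENCY (the skeleton with the lever as an explicit
  hypothesis): the cube-root law `CubeRootLaw` (the macroscopic, flat-marked, closure-discretised,
  raw-mass double-ratio law: on pairs of fixed flat windows the increments of the percolation tail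
  function `Q_δ = tailCrossingProb` are proportional to the increments of the cube-root kernel mass
  `rowMass`, with one constant, eventually up to relative error `ε`) implies Cardy's formula for bond
  percolation on `ℤ²` in every rectilinear conformal rectangle;
* `cubeRootLaw_of_rectilinearCardy` — NECESSITY: conversely the crux implies the cube-root law
  (apply the crux to the sub-rectangles `(Ω; a, b, ∂Ω(p), d)`, `p` in a flat window, whose crossing
  probability IS `Q_δ(p)`, and compare with the landed kernel window law);
* `rectilinearCardy_iff_cubeRootLaw` — hence the lever `stub_cubeRootLaw` is EXACTLY crux-sized: it is
  a reformulation of Cardy's formula on rectilinear polygons as a local boundary density law read against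
  the lattice polygon's own excursion kernels (the `(1,1,1;3)` member of the route's boundary Coulomb gas),
  the form in which the route's engine `BoundaryDefectGaussianR` (stmt-14132) is meant to deliver it —
  so the open support item `DensityIntegration` (stmt-14890, `BoundaryDefectGaussianR → RectilinearCardy`)
  is now reduced to `BoundaryDefectGaussianR → CubeRootLaw`.

The statement `CubeRootLaw` is written INLINE (it is the registered signature of `stub_cubeRootLaw`,
over the landed vocabulary `tailCrossingProb`, `rowMass`, `AdmissibleRange`, `FlatNear`, `IsRectilinear`).
-/

noncomputable section

open Set Filter Topology MeasureTheory
open Literature.Probability.RandomPlanarGeometry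
open Literature.Probability.Percolation (bondDomainCrossingProb discreteCrossingProb half)
open Summit.CriticalPhenomena.CardyFormulaZ2.Theorems.RectilinearCardy.Negative (IsRectilinear)
open Summit.CriticalPhenomena.CardyFormulaZ2.Theses.CardyBoundaryCoulombGas (RectilinearCardy)
open UpperHalfPlane (upperHalfPlaneSet)

namespace Summit.CriticalPhenomena.CardyFormulaZ2.Cruxes.RectilinearCardy.ExcursionKernelCovariance
/-! ### Sufficiency: the cube-root law implies the crux -/

/-- **SUFFICIENCY — the cube-root law implies Cardy's formula for bond-`ℤ²` in every rectilinear
conformal rectangle.** This is the reshaped skeleton of the line with its one open stub as an explicit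
hypothesis: flat-marks reduction (`stub_flatMarksReduction`), then the landed abstract gluing lemma
`localToGlobal_abstract` with `Q := tailCrossingProb R` and the constant-in-`δ` comparison family
`C = contTail R g` (`stub_continuumTail`), percolation tightness (`stub_boundaryArmTightness`), finite
corners, and the double-ratio law for `(Q, C)` obtained by transporting the hypothesis along the kernel
window law (`exists_kernelWindowDatum`); at `s = mark 2` the limit is `F(crossRatio x)` for the
uniformizing datum `x i = g (mark i)`, and the cross-ratio is datum-independent. [folklore] -/
theorem rectilinearCardy_of_cubeRootLaw
    (h₁ : ∀ R : ConformalRectangle, IsRectilinear R →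
      (∀ i : Fin 4, ∃ r : ℝ, 0 < r ∧ FlatNear R (R.pt i) r) →
      ∀ σ σ' τ τ' : ℝ, AdmissibleRange R σ σ' → AdmissibleRange R τ τ' →
        ∀ ε : ℝ, 0 < ε → ∀ s s' t t' : ℝ,
          σ ≤ s → s ≤ s' → s' ≤ σ' → τ ≤ t → t ≤ t' → t' ≤ τ' → ∀ᶠ δ in 𝓝[>] (0 : ℝ),
            |(tailCrossingProb R δ s - tailCrossingProb R δ s') * (rowMass R δ t - rowMass R δ t') -
                (tailCrossingProb R δ t - tailCrossingProb R δ t') * (rowMass R δ s - rowMass R δ s')|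
              ≤ ε * ((tailCrossingProb R δ s - tailCrossingProb R δ s') *
                  (rowMass R δ t - rowMass R δ t') +
                (tailCrossingProb R δ t - tailCrossingProb R δ t') *
                  (rowMass R δ s - rowMass R δ s'))) :
    RectilinearCardy := by
  refine stub_flatMarksReduction stub_boundaryCorrespondence ?_
  intro R hR hF φ' x' hφx'
  obtain ⟨φ, g, S₀, S, hS₀, h3S, hS1, hSS₀, hgc, hgm, hbv, c, hcpos, hclaw⟩ :=
    exists_kernelWindowDatum R hR hF
  have hsub : Icc (0 : ℝ) (R.mark 3) ⊆ Icc S₀ S := Icc_subset_Icc hS₀.le h3S.le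
  have hgc' : ContinuousOn g (Icc 0 (R.mark 3)) := hgc.mono hsub
  have hgm' : StrictMonoOn g (Icc 0 (R.mark 3)) ∨ StrictAntiOn g (Icc 0 (R.mark 3)) :=
    hgm.imp (fun h => h.mono hsub) (fun h => h.mono hsub)
  obtain ⟨-, hCa, hC1, hC3, hCt⟩ := stub_continuumTail R g hgc' hgm'
  obtain ⟨T, hT⟩ := stub_finiteCorners R hR
  obtain ⟨hQtight, hQ1, hQ3⟩ := stub_boundaryArmTightness R hR
  have h13 : R.mark 1 < R.mark 3 := R.strictMono_mark (show (1 : Fin 4) < 3 by decide)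
  have hmI : ∀ i : Fin 4, R.mark i ∈ Icc (0 : ℝ) (R.mark 3) := fun i =>
    ⟨(R.mark_mem i).1, R.strictMono_mark.monotone (Fin.le_last i)⟩
  -- the uniformizing datum read off the boundary correspondence
  set x : Fin 4 → ℝ := fun i => g (R.mark i) with hx
  have hU : R.IsUniformizing φ x := by
    refine ⟨?_, fun i => hbv _ (hsub (hmI i))⟩
    exact hgm'.imp (fun h a b hab => h (hmI a) (hmI b) (R.strictMono_mark hab))
      (fun h a b hab => h (hmI a) (hmI b) (R.strictMono_mark hab))
  -- the glue: `Q_δ(s) - C(s) → 0` for every `s`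
  have key : ∀ s ∈ Icc (R.mark 1) (R.mark 3),
      Tendsto (fun δ => tailCrossingProb R δ s - contTail R g s) (𝓝[>] 0) (𝓝 0) := by
    refine localToGlobal_abstract (Q := fun δ s => tailCrossingProb R δ s)
      (ν := fun _ s => contTail R g s)
      (Good := fun s => ∃ r : ℝ, 0 < r ∧ FlatNear R (R.boundary s) r) (Adm := AdmissibleRange R)
      h13 R.continuous_boundary T hT ?_ ?_ ?_ ?_ ?_ hQ1 hQ3 ?_ hQtight ?_ ?_
    · intro σ σ' hσ hσσ' hσ' hgood
      exact ⟨hσ, hσσ', hσ', exists_uniform_flatRadius R hgood⟩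
    · exact Eventually.of_forall fun δ a ha b hb hab => tailCrossingProb_antitone R δ ha.1 hab hb.2
    · exact Eventually.of_forall fun δ => hCa.antitoneOn
    · exact Eventually.of_forall fun δ => measureReal_le_one
    · exact Eventually.of_forall fun δ => hC1
    · simpa only [contTail, hC3] using tendsto_const_nhds
    · intro ε hε
      obtain ⟨ρ, hρ, h⟩ := hCt ε hε
      exact ⟨ρ, hρ, Eventually.of_forall fun δ => h⟩
    · -- the double-ratio law for `(Q, C)`: the hypothesis transported along the kernel window law
      intro σ σ' τ τ' hσ hτ ε hε s s' t t' hs hss' hs' ht htt' ht'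
      set ε₀ : ℝ := min 1 (ε / 3) with hε₀
      have hε₀pos : 0 < ε₀ := lt_min one_pos (by linarith)
      have hε₀1 : ε₀ ≤ 1 := min_le_left _ _
      have hε₀3 : 3 * ε₀ ≤ ε := by
        have := min_le_right 1 (ε / 3); linarith
      have hlaw := h₁ R hR hF σ σ' τ τ' hσ hτ ε₀ hε₀pos s s' t t' hs hss' hs' ht htt' ht'
      have hCs : 0 ≤ contTail R g s - contTail R g s' :=
        sub_nonneg.2 (hCa.antitoneOn ⟨hσ.1.le.trans hs, hss'.trans (hs'.trans hσ.2.2.1.le)⟩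
          ⟨hσ.1.le.trans (hs.trans hss'), hs'.trans hσ.2.2.1.le⟩ hss')
      have hCt' : 0 ≤ contTail R g t - contTail R g t' :=
        sub_nonneg.2 (hCa.antitoneOn ⟨hτ.1.le.trans ht, htt'.trans (ht'.trans hτ.2.2.1.le)⟩
          ⟨hτ.1.le.trans (ht.trans htt'), ht'.trans hτ.2.2.1.le⟩ htt')
      have hdeg : ∀ {p p' : ℝ}, p ≤ p' → p' ≤ R.mark 3 → R.mark 1 ≤ p →
          contTail R g p - contTail R g p' = 0 → ∀ δ,
            c δ * (rowMass R δ p - rowMass R δ p') = 0 := by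
        intro p p' hpp' hp' hp h0 δ
        rcases hpp'.eq_or_lt with rfl | hlt
        · simp
        · exact absurd h0 (ne_of_gt (sub_pos.2 (hCa ⟨hp, hpp'.trans hp'⟩
            ⟨hp.trans hpp', hp'⟩ hlt)))
      have hus := eventually_abs_sub_le_of_tendsto hε₀pos hCs (hclaw σ σ' hσ s s' hs hss' hs')
        (hdeg hss' (hs'.trans hσ.2.2.1.le) (hσ.1.le.trans hs))
      have hut := eventually_abs_sub_le_of_tendsto hε₀pos hCt' (hclaw τ τ' hτ t t' ht htt' ht')
        (hdeg htt' (ht'.trans hτ.2.2.1.le) (hτ.1.le.trans ht))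
      filter_upwards [hlaw, hus, hut] with δ hδ hu hu'
      have hQs : 0 ≤ tailCrossingProb R δ s - tailCrossingProb R δ s' :=
        sub_nonneg.2 (tailCrossingProb_antitone R δ (hσ.1.le.trans hs) hss'
          (hs'.trans hσ.2.2.1.le))
      have hQt : 0 ≤ tailCrossingProb R δ t - tailCrossingProb R δ t' :=
        sub_nonneg.2 (tailCrossingProb_antitone R δ (hτ.1.le.trans ht) htt'
          (ht'.trans hτ.2.2.1.le))
      have hδ' := doubleRatio_scale (k := c δ) (hcpos δ) hδ
      have := doubleRatio_transfer hQs hQt hCs hCt' hε₀pos.le hε₀1 hδ' hu hu'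
      refine this.trans ?_
      have hS : 0 ≤ (tailCrossingProb R δ s - tailCrossingProb R δ s') *
          (contTail R g t - contTail R g t') +
          (tailCrossingProb R δ t - tailCrossingProb R δ t') * (contTail R g s - contTail R g s') := by
        positivity
      nlinarith
  -- at `s = mark 2`: `Q_δ(mark 2) → C(mark 2) = F(crossRatio x)`
  have hQ : Tendsto (fun δ => tailCrossingProb R δ (R.mark 2)) (𝓝[>] 0)
      (𝓝 (contTail R g (R.mark 2))) := by
    have := (key (R.mark 2) (mark_two_mem_Icc R)).add
      (tendsto_const_nhds (x := contTail R g (R.mark 2)))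
    simpa only [sub_add_cancel, zero_add] using this
  rw [contTail_mark_two] at hQ
  rw [ConformalRectangle.crossRatio_eq_of_isUniformizing_holds hφx' hU]
  refine hQ.congr fun δ => ?_
  exact tailCrossingProb_mark_two R δ

/-! ### Necessity: the crux implies the cube-root law -/

/-- **NECESSITY — Cardy's formula on rectilinear polygons implies the cube-root law.** For a
flat-marked rectilinear `R` and fixed windows `[s,s'], [t,t']` in admissible ranges: by the crux applied
to the sub-rectangles `(Ω; a, b, ∂Ω(p), d)` (`tendsto_tailCrossingProb_of_rectilinearCardy`) the
increments `ΔQ_δ` converge to the increments `ΔC` of the continuum tail, and by the landed kernel window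
law so do the renormalised kernel masses `c δ ΔrowMass`; two families with the same limits obey the
double-ratio law eventually (`eventually_doubleRatio_of_tendsto`; degenerate windows are exact zeros),
and the normaliser `c δ > 0` scales out. [folklore] -/
theorem cubeRootLaw_of_rectilinearCardy (h : RectilinearCardy) :
    ∀ R : ConformalRectangle, IsRectilinear R →
      (∀ i : Fin 4, ∃ r : ℝ, 0 < r ∧ FlatNear R (R.pt i) r) →
      ∀ σ σ' τ τ' : ℝ, AdmissibleRange R σ σ' → AdmissibleRange R τ τ' →
        ∀ ε : ℝ, 0 < ε → ∀ s s' t t' : ℝ,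
          σ ≤ s → s ≤ s' → s' ≤ σ' → τ ≤ t → t ≤ t' → t' ≤ τ' → ∀ᶠ δ in 𝓝[>] (0 : ℝ),
            |(tailCrossingProb R δ s - tailCrossingProb R δ s') * (rowMass R δ t - rowMass R δ t') -
                (tailCrossingProb R δ t - tailCrossingProb R δ t') * (rowMass R δ s - rowMass R δ s')|
              ≤ ε * ((tailCrossingProb R δ s - tailCrossingProb R δ s') *
                  (rowMass R δ t - rowMass R δ t') +
                (tailCrossingProb R δ t - tailCrossingProb R δ t') *
                  (rowMass R δ s - rowMass R δ s')) := by
  intro R hR hF σ σ' τ τ' hσ hτ ε hε s s' t t' hs hss' hs' ht htt' ht'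
  obtain ⟨φ, g, S₀, S, hS₀, h3S, hS1, hSS₀, hgc, hgm, hbv, c, hcpos, hclaw⟩ :=
    exists_kernelWindowDatum R hR hF
  have hsub : Icc (0 : ℝ) (R.mark 3) ⊆ Icc S₀ S := Icc_subset_Icc hS₀.le h3S.le
  obtain ⟨-, hCa, -⟩ := stub_continuumTail R g (hgc.mono hsub)
    (hgm.imp (fun h => h.mono hsub) (fun h => h.mono hsub))
  -- parameters of the two windows are strictly inside `(mark 1, mark 3)`
  have h1s : R.mark 1 < s := hσ.1.trans_le hs
  have hs'3 : s' < R.mark 3 := lt_of_le_of_lt hs' hσ.2.2.1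
  have h1t : R.mark 1 < t := hτ.1.trans_le ht
  have ht'3 : t' < R.mark 3 := lt_of_le_of_lt ht' hτ.2.2.1
  have hQ : ∀ p : ℝ, R.mark 1 < p → p < R.mark 3 →
      Tendsto (fun δ => tailCrossingProb R δ p) (𝓝[>] 0) (𝓝 (contTail R g p)) := fun p h1 h3 =>
    tendsto_tailCrossingProb_of_rectilinearCardy h R hR hS₀ h3S hgm hbv h1 h3
  -- the four convergences
  have has : Tendsto (fun δ => tailCrossingProb R δ s - tailCrossingProb R δ s') (𝓝[>] 0)
      (𝓝 (contTail R g s - contTail R g s')) :=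
    (hQ s h1s (lt_of_le_of_lt hss' hs'3)).sub (hQ s' (h1s.trans_le hss') hs'3)
  have hat : Tendsto (fun δ => tailCrossingProb R δ t - tailCrossingProb R δ t') (𝓝[>] 0)
      (𝓝 (contTail R g t - contTail R g t')) :=
    (hQ t h1t (lt_of_le_of_lt htt' ht'3)).sub (hQ t' (h1t.trans_le htt') ht'3)
  have hus := hclaw σ σ' hσ s s' hs hss' hs'
  have hut := hclaw τ τ' hτ t t' ht htt' ht'
  have hCs : 0 ≤ contTail R g s - contTail R g s' :=
    sub_nonneg.2 (hCa.antitoneOn ⟨h1s.le, hss'.trans hs'3.le⟩ ⟨h1s.le.trans hss', hs'3.le⟩ hss')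
  have hCt' : 0 ≤ contTail R g t - contTail R g t' :=
    sub_nonneg.2 (hCa.antitoneOn ⟨h1t.le, htt'.trans ht'3.le⟩ ⟨h1t.le.trans htt', ht'3.le⟩ htt')
  -- degenerate windows are exact zeros
  have hdeg : ∀ {p p' : ℝ}, R.mark 1 < p → p ≤ p' → p' < R.mark 3 →
      contTail R g p - contTail R g p' = 0 → ∀ δ,
        tailCrossingProb R δ p - tailCrossingProb R δ p' = 0 ∧
          c δ * (rowMass R δ p - rowMass R δ p') = 0 := by
    intro p p' hp hpp' hp' h0 δ
    rcases hpp'.eq_or_lt with rfl | hlt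
    · simp
    · exact absurd h0 (ne_of_gt (sub_pos.2 (hCa ⟨hp.le, hpp'.trans hp'.le⟩
        ⟨hp.le.trans hpp', hp'.le⟩ hlt)))
  have hev := eventually_doubleRatio_of_tendsto hε hCs hCt' has hat hus hut
    (hdeg h1s hss' hs'3) (hdeg h1t htt' ht'3)
  filter_upwards [hev] with δ hδ
  -- scale the normaliser `c δ > 0` out of the kernel increments
  have := doubleRatio_scale (k := (c δ)⁻¹) (inv_pos.2 (hcpos δ)) hδ
  have e : ∀ p p' : ℝ, (c δ)⁻¹ * (c δ * (rowMass R δ p - rowMass R δ p')) =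
      rowMass R δ p - rowMass R δ p' := fun p p' => by
    rw [← mul_assoc, inv_mul_cancel₀ (hcpos δ).ne', one_mul]
  rwa [e, e] at this

/-- **The crux is EQUIVALENT to the cube-root law**: `stub_cubeRootLaw`, the one open stub of the line
`excursion-kernel-covariance`, is exactly crux-sized — a reformulation of Cardy's formula for bond-`ℤ²`
on rectilinear polygons as the local density law of the `d`-most boundary vertex joined to `(ab)`
against the cube root of the product of the lattice polygon's three excursion kernels. [folklore] -/
theorem rectilinearCardy_iff_cubeRootLaw :
    RectilinearCardy ↔
      ∀ R : ConformalRectangle, IsRectilinear R →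
        (∀ i : Fin 4, ∃ r : ℝ, 0 < r ∧ FlatNear R (R.pt i) r) →
        ∀ σ σ' τ τ' : ℝ, AdmissibleRange R σ σ' → AdmissibleRange R τ τ' →
          ∀ ε : ℝ, 0 < ε → ∀ s s' t t' : ℝ,
            σ ≤ s → s ≤ s' → s' ≤ σ' → τ ≤ t → t ≤ t' → t' ≤ τ' → ∀ᶠ δ in 𝓝[>] (0 : ℝ),
              |(tailCrossingProb R δ s - tailCrossingProb R δ s') * (rowMass R δ t - rowMass R δ t') -
                  (tailCrossingProb R δ t - tailCrossingProb R δ t') *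
                    (rowMass R δ s - rowMass R δ s')|
                ≤ ε * ((tailCrossingProb R δ s - tailCrossingProb R δ s') *
                    (rowMass R δ t - rowMass R δ t') +
                  (tailCrossingProb R δ t - tailCrossingProb R δ t') *
                    (rowMass R δ s - rowMass R δ s')) :=
  ⟨cubeRootLaw_of_rectilinearCardy, rectilinearCardy_of_cubeRootLaw⟩

end Summit.CriticalPhenomena.CardyFormulaZ2.Cruxes.RectilinearCardy.ExcursionKernelCovariance

end
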